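import Mathlib
import Summits.AtomisticToContinuum.Crystallization.Theses.LaminarSixThreeThree
import Summits.AtomisticToContinuum.Crystallization.Theorems.LaminarSixThreeThreeLaminarToBarlow

/-!
# Birth skeleton — crux `LaminarSixThreeThree.LaminarBarlowWindows` (stmt-AtomisticToContinuum-14292)

Route `route-AtomisticToContinuum-LaminarSixThreeThree`, sub-problem `Crystallization`; crux workfile
`Cruxes/LaminarBarlowWindows/Lines/birth.lean` (BC3 skeleton, registered with `ledger skeleton check`).

The crux is the route's thesis X (BARLOW WINDOWS a.e.): for every radius `R > 0` and tolerance
`ε ∈ (0, 1/4)`, along every sequence of Lennard-Jones ground states in `ℝ³` the fraction of particles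
whose `R`-window is NOT two-way `ε`-matched (after a rigid motion) to a window of SOME Barlow stacking
`barlowStacking a h s` (`a, h ∈ (1/2, 2)`, `s` a Hägg word) tends to `0`.  It was back-filled as a crux
(auto-crux, 2026-08-16) because the deciding theorem `closes` carries it as a binder; inside the route it
is DERIVED from the three ranked laminar cruxes by the landed glue `LaminarToBarlow`
(`Theorems/LaminarSixThreeThreeLaminarToBarlow.lean`, item stmt-14298, proved).

## The line (the route's own laminar chain, not re-cut)

* `stub_laminarity  : LjLaminarity`      — route crux stmt-14293 (rank 2, the BET: a.e. particle sees thin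
  parallel layers; open-problem grade);
* `stub_saturation  : LaminarSaturation` — route crux stmt-14294 (rank 3, ENERGY step, XL: laminarity ⇒
  a.e. particle has a GOOD window — 6 + 3 + 3 ε-sharp bonds in `[19/20, 1]`, levels with gaps `≥ 19/25`);
* `stub_rigidity    : LaminarRigidity`   — route crux stmt-14295 (rank 4, GEOMETRY step, L: a GOOD
  `(R, ε)`-window is `C(R)·ε`-Barlow on radius `R/4`, for `R ≥ 16`, `ε ≤ 10⁻³`).

Composition (sorry-free): `LaminarBarlowWindows_of : LjLaminarity → LaminarSaturation → LaminarRigidity →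
LaminarBarlowWindows`, through the sharper `barlowWindows_of_goodWindows`, which records that X uses the
energy side ONLY through "GOOD windows almost everywhere" (`GoodWindowsAE`, the consequent of
`LaminarSaturation`): given `R, ε`, invoke good windows at `R' = max (4R) 16`,
`ε' = min (ε / max (C R') 1) (1/1000)` and rigidity at `(R', ε')`; two-way matching is monotone in radius
and tolerance, so the bad set of X at `(R, ε)` sits inside the non-GOOD set at `(R', ε')` for every `N`
and the `Tendsto` passes by `Nat.card` comparison + `squeeze_zero` (the argument of
`laminarToBarlow_proof`, restated with the weakest hypothesis it consumes).  Hence any other engine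
delivering `GoodWindowsAE` (e.g. a re-base on the windowed laminarity `LjLaminarWindows` of route
ChessboardParticlePlanes, foreseen in the route's two-layer plan) feeds X through the same theorem.

`LaminarBarlowWindows_skeleton : LaminarBarlowWindows` is the crux modulo the three stubs (sorries only
inside `stub_*`).  Nothing here restates the crux or the summit: no stub implies `LaminarBarlowWindows` or
`Crystallization` by `first | exact? | simpa | aesop` (BC3 probes, folder `bc/probes_*.lean`, all fail),
and X itself is not the summit (X → Crystallization needs `StackingFaultSparsity` + the hcp/hull chain +
conjunct (i)).
-/

noncomputable section

namespace Summit.AtomisticToContinuum.Crystallization.Cruxes.LaminarBarlowWindows.Birth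

open Literature.MathematicalPhysics.StatisticalMechanics
open Summit.AtomisticToContinuum.Crystallization.Theses.LaminarSixThreeThree

/-- Ambient space `ℝ³`. -/
abbrev E3 := EuclideanSpace ℝ (Fin 3)

/-! ## The two window predicates of the line, named (verbatim clauses of the route decls) -/

/-- GOOD `(R, ε)`-window at site `i` (verbatim the clause negated inside `LaminarSaturation` and assumed
by `LaminarRigidity`): bond lengths `a` (in-plane), `b` (inter-layer) in `[19/20, 1]`, a unit normal `n`,
levels `c` with gaps `≥ 19/25`, a level index `l` with every particle within `R` of `x i` within `ε` of
its level, pairwise separation `≥ 19/20` on the window, and for every `j` within `R/2` of `x i` exactly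
`6` same-level, `3` level-up and `3` level-down particles within distance `1`, each bond `ε`-close to
`a` resp. `b`. -/
def GoodWindow (R ε : ℝ) {N : ℕ} (x : Fin N → E3) (i : Fin N) : Prop :=
  ∃ a b : ℝ, 19 / 20 ≤ a ∧ a ≤ 1 ∧ 19 / 20 ≤ b ∧ b ≤ 1 ∧ ∃ n : EuclideanSpace ℝ (Fin 3), ‖n‖ = 1 ∧
    ∃ c : ℤ → ℝ, (∀ k : ℤ, c k + 19 / 25 ≤ c (k + 1)) ∧ ∃ l : Fin N → ℤ,
      (∀ j : Fin N, dist (x j) (x i) ≤ R → |inner ℝ (x j - x i) n - c (l j)| ≤ ε) ∧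
      (∀ j k : Fin N, dist (x j) (x i) ≤ R → dist (x k) (x i) ≤ R → j ≠ k → 19 / 20 ≤ dist (x j) (x k)) ∧
      ∀ j : Fin N, dist (x j) (x i) ≤ R / 2 →
        Nat.card {k : Fin N // k ≠ j ∧ l k = l j ∧ dist (x j) (x k) ≤ 1} = 6 ∧
        Nat.card {k : Fin N // l k = l j + 1 ∧ dist (x j) (x k) ≤ 1} = 3 ∧
        Nat.card {k : Fin N // l k = l j - 1 ∧ dist (x j) (x k) ≤ 1} = 3 ∧
        ∀ k : Fin N, k ≠ j → dist (x j) (x k) ≤ 1 →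
          (l k = l j → |dist (x j) (x k) - a| ≤ ε) ∧ (l k ≠ l j → |dist (x j) (x k) - b| ≤ ε)

/-- BARLOW-MATCHED `(R, δ)`-window at site `i` (verbatim the clause negated inside the crux): the
`R`-window of `x i` is two-way `δ`-matched, after a linear isometry `A`, to the `R`-window of a point
`z` of some Barlow stacking `barlowStacking a h s` (`a, h ∈ (1/2, 2)`, `s` a Hägg sequence). -/
def BarlowMatched (R δ : ℝ) {N : ℕ} (x : Fin N → E3) (i : Fin N) : Prop :=
  ∃ a h : ℝ, 1 / 2 < a ∧ a < 2 ∧ 1 / 2 < h ∧ h < 2 ∧ ∃ s : ℤ → ℤ, IsHaggSeq s ∧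
    ∃ z ∈ barlowStacking a h s, ∃ A : EuclideanSpace ℝ (Fin 3) →ₗᵢ[ℝ] EuclideanSpace ℝ (Fin 3),
      (∀ p ∈ barlowStacking a h s, dist p z ≤ R → ∃ j : Fin N, dist (x j) (x i + A (p - z)) ≤ δ) ∧
      (∀ j : Fin N, dist (x j) (x i) ≤ R → ∃ p ∈ barlowStacking a h s, dist (x j) (x i + A (p - z)) ≤ δ)

/-- GOOD WINDOWS ALMOST EVERYWHERE (the consequent of `LaminarSaturation`, i.e. what the energy side of
the line must deliver): for every `R ≥ 2`, `ε > 0` and every sequence of Lennard-Jones ground states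
the fraction of particles without a GOOD `(R, ε)`-window tends to `0`. -/
def GoodWindowsAE : Prop :=
  ∀ R ε : ℝ, 2 ≤ R → 0 < ε → ∀ x : (N : ℕ) → (Fin N → E3),
    (∀ N, IsGroundState lennardJones (x N)) →
      Filter.Tendsto (fun N : ℕ => (Nat.card {i : Fin N // ¬ GoodWindow R ε (x N) i} : ℝ) / N)
        Filter.atTop (nhds 0)

/-- The crux through the named predicate (definitional unfolding). -/
theorem crux_iff :
    LaminarBarlowWindows ↔
      ∀ R ε : ℝ, 0 < R → 0 < ε → ε < 1 / 4 → ∀ x : (N : ℕ) → (Fin N → E3),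
        (∀ N, IsGroundState lennardJones (x N)) →
          Filter.Tendsto (fun N : ℕ => (Nat.card {i : Fin N // ¬ BarlowMatched R ε (x N) i} : ℝ) / N)
            Filter.atTop (nhds 0) :=
  Iff.rfl

/-- `LaminarSaturation` is literally `LjLaminarity → GoodWindowsAE`. -/
theorem saturation_iff : LaminarSaturation ↔ (LjLaminarity → GoodWindowsAE) := Iff.rfl

/-- `LaminarRigidity` through the named predicates: a GOOD `(R, ε)`-window is Barlow-matched at
`(R/4, C R * ε)`. -/
theorem rigidity_iff :
    LaminarRigidity ↔
      ∃ C : ℝ → ℝ, ∀ R ε : ℝ, 16 ≤ R → 0 < ε → ε ≤ 1 / 1000 →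
        ∀ (N : ℕ) (x : Fin N → E3) (i : Fin N), GoodWindow R ε x i → BarlowMatched (R / 4) (C R * ε) x i :=
  Iff.rfl

/-! ## The stubs (registered obligations = the route's three laminar cruxes, by name) -/

/-- **Stub 1 — LAMINARITY a.e.** (route crux `LjLaminarity`, stmt-AtomisticToContinuum-14293, rank 2;
the bet of the laminar hypothesis class): for every thickness `t > 0` and radius `R > 0`, along every
sequence of LJ ground states the fraction of particles whose `R`-neighbourhood does NOT lie within `t`
of a family of parallel level planes with consecutive gaps `≥ 3/4` tends to `0`.  Why it might fail:
bulk polytetrahedral / icosahedral order at positive density (DoyeCalvo2002).  Size: open-problem. -/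
theorem stub_laminarity : LjLaminarity := by
  sorry

/-- **Stub 2 — SATURATION in the laminar class** (route crux `LaminarSaturation`,
stmt-AtomisticToContinuum-14294, rank 3): `LjLaminarity → GoodWindowsAE` — inside thin layers the
laminar kissing cap `6 + 3 + 3` (proved: `LaminarKissingCap`) and the trial bound
`E(N) ≤ N·e(hcp) + O(N^(2/3))` force exactly `6 + 3 + 3` ε-sharp bonds off `o(N)` particles.  Why it
might fail: the `r⁻⁶` tail is not bond-local (compressed / square-buckled bilayers).  Size: XL. -/
theorem stub_saturation : LaminarSaturation := by
  sorry

/-- **Stub 3 — LAMINAR RIGIDITY** (route crux `LaminarRigidity`, stmt-AtomisticToContinuum-14295,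
rank 4; pure geometry): some `C : ℝ → ℝ` such that for `R ≥ 16`, `0 < ε ≤ 1/1000` every GOOD
`(R, ε)`-window of any finite configuration is Barlow-matched at `(R/4, C R * ε)` (hexagonal rings by
angle bookkeeping, up-triples occupy alternate faces, one Hägg letter per layer pair).  Why it might
fail: one GOOD window that is not `O(ε)`-Barlow on `R/4`.  Size: L. -/
theorem stub_rigidity : LaminarRigidity := by
  sorry

/-! ## Composition (sorry-free) -/

/-- Arithmetic of the tolerances (as in the landed glue): with `ε' = min (ε / max c 1) (1/1000)` and
`0 < ε` one has `0 < ε'`, `ε' ≤ 1/1000` and `c * ε' ≤ ε`, whatever the sign of `c`. -/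
theorem tolerance_aux (c ε : ℝ) (hε : 0 < ε) :
    0 < min (ε / max c 1) (1 / 1000) ∧ min (ε / max c 1) (1 / 1000) ≤ 1 / 1000 ∧
      c * min (ε / max c 1) (1 / 1000) ≤ ε :=
  Summit.AtomisticToContinuum.Crystallization.Theorems.laminarToBarlow_tolerance c ε hε

/-- Monotonicity of Barlow matching in radius and tolerance. -/
theorem barlowMatched_mono {R R' δ δ' : ℝ} {N : ℕ} {x : Fin N → E3} {i : Fin N}
    (hR : R ≤ R') (hδ : δ' ≤ δ) (h : BarlowMatched R' δ' x i) : BarlowMatched R δ x i := by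
  obtain ⟨a, h, ha1, ha2, hh1, hh2, s, hs, z, hz, A, hA1, hA2⟩ := h
  refine ⟨a, h, ha1, ha2, hh1, hh2, s, hs, z, hz, A, ?_, ?_⟩
  · intro p hp hpz
    obtain ⟨j, hj⟩ := hA1 p hp (hpz.trans hR)
    exact ⟨j, hj.trans hδ⟩
  · intro j hj
    obtain ⟨p, hp, hpj⟩ := hA2 j (hj.trans hR)
    exact ⟨p, hp, hpj.trans hδ⟩

/-- **The real step of the composition.** GOOD windows a.e. and laminar rigidity give Barlow windows
a.e. (the conclusion is the crux, spelled through `BarlowMatched`; see `crux_iff`): at `(R, ε)` invoke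
good windows at `R' = max (4R) 16`, `ε' = min (ε / max (C R') 1) (1/1000)`, rigidity at `(R', ε')`,
then `barlowMatched_mono` (`R ≤ R'/4`, `C R' * ε' ≤ ε`) puts the bad set of the crux inside the
non-GOOD set for every `N`; `Nat.card` comparison and `squeeze_zero`. -/
theorem barlowWindows_of_goodWindows (hGood : GoodWindowsAE) (hRig : LaminarRigidity) :
    ∀ R ε : ℝ, 0 < R → 0 < ε → ε < 1 / 4 → ∀ x : (N : ℕ) → (Fin N → E3),
      (∀ N, IsGroundState lennardJones (x N)) →
        Filter.Tendsto (fun N : ℕ => (Nat.card {i : Fin N // ¬ BarlowMatched R ε (x N) i} : ℝ) / N)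
          Filter.atTop (nhds 0) := by
  intro R ε hR hε _hε4 x hx
  obtain ⟨C, hC⟩ := (rigidity_iff.mp hRig)
  -- the radius and tolerance at which good windows and rigidity are invoked
  set R' : ℝ := max (4 * R) 16 with hR'def
  have hR'16 : (16 : ℝ) ≤ R' := le_max_right _ _
  have hR'2 : (2 : ℝ) ≤ R' := le_trans (by norm_num) hR'16
  have hRR' : R ≤ R' / 4 := by
    have h4 : 4 * R ≤ R' := le_max_left _ _
    linarith
  obtain ⟨hε'pos, hε'le, hCε'⟩ := tolerance_aux (C R') ε hε
  set ε' : ℝ := min (ε / max (C R') 1) (1 / 1000) with hε'def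
  -- good windows: the fraction of particles without a GOOD (R', ε')-window tends to zero
  have hT := hGood R' ε' hR'2 hε'pos x hx
  refine squeeze_zero (fun N => ?_) (fun N => ?_) hT
  · positivity
  · refine div_le_div_of_nonneg_right (Nat.cast_le.mpr ?_) (Nat.cast_nonneg N)
    -- the bad set of the crux lies inside the non-GOOD set
    refine Nat.card_le_card_of_injective
      (Subtype.map id fun i hi hgood => hi ?_) (Subtype.map_injective _ Function.injective_id)
    -- rigidity: a GOOD (R', ε')-window is Barlow-matched at (R' / 4, C R' * ε'), hence at (R, ε)
    exact barlowMatched_mono hRR' hCε' (hC R' ε' hR'16 hε'pos hε'le N (x N) i hgood)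

/-- **Composition `LaminarBarlowWindows_of`** (sorry-free; hypotheses = the three registered stubs'
statements, by name): `LjLaminarity → LaminarSaturation → LaminarRigidity → LaminarBarlowWindows`. -/
theorem LaminarBarlowWindows_of :
    LjLaminarity → LaminarSaturation → LaminarRigidity → LaminarBarlowWindows := by
  intro hLam hSat hRig
  exact crux_iff.mpr (barlowWindows_of_goodWindows (saturation_iff.mp hSat hLam) hRig)

/-- The same composition is (definitionally) the landed glue item `LaminarToBarlow` (stmt-14298). -/
example : LjLaminarity → LaminarSaturation → LaminarRigidity → LaminarBarlowWindows :=
  Summit.AtomisticToContinuum.Crystallization.Theorems.laminarToBarlow_proof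

/-- **The crux modulo the three stubs** (sorries only inside `stub_*`). -/
theorem LaminarBarlowWindows_skeleton : LaminarBarlowWindows :=
  LaminarBarlowWindows_of stub_laminarity stub_saturation stub_rigidity

end Summit.AtomisticToContinuum.Crystallization.Cruxes.LaminarBarlowWindows.Birth

end
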